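/-
COR-CM (cell pub-hodgecm2, stage 2 of the Hodge ladder): an UNCONDITIONAL universe with the CM-type facts M13 + M14.
Seat prover-pub-hodgecm2-b14 (gen 7), 2026-08-20.  Companion of `CorCM/Geometry/PerLShadow.lean` (its hypotheses
`Fact_eigenLine`, `Fact_alphaLine` are discharged here without any cited record).
-/
import Summits.HodgeConjecture.CorCM.Model.PerLConeFacts
import Summits.HodgeConjecture.CorCM.Geometry.NonVacuity
import Literature.AlgebraicGeometry.Motives.WeilTypeCMProofs
import Literature.AlgebraicGeometry.Motives.HodgeStructureWeil
import Literature.AlgebraicGeometry.Motives.HodgeStructureNonempty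
import HarnessLib

/-!
# The CM-type universe: `H¹(A_{(K,Φ)}) := K` with the Hodge structure of the CM type `Φ`

A record-free universe `cmTypeUniverse : Universe` whose CM side is the textbook linear algebra of a CM type
(Deligne, LNM 900, Example 3.7 and §4: `E ⊗_ℚ ℂ = ⊕_σ ℂ_σ`, `H^{1,0} = ⊕_{σ ∈ Φ} ℂ_σ`), so that the two CM-type
model facts hold on it UNCONDITIONALLY:

* M13 `cmTypeUniverse_fact_eigenLine : cmTypeUniverse.Fact_eigenLine` — every eigen-line `H¹(A_{(K,Φ)}, ℂ)_σ` is a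
  line;
* M14 `cmTypeUniverse_fact_alphaLine : cmTypeUniverse.Fact_alphaLine` — it is holomorphic iff `σ ∈ Φ`.

Construction (`CMTypeHodge`, for a number field `E` and a CM type `Φ` of `E`): the `σ`-eigen-lines
`L_σ ⊆ ℂ ⊗_ℚ E` of the multiplication action of `E` on itself span `ℂ ⊗_ℚ E`, are independent, are exchanged by
complex conjugation (`conj L_σ = L_σ̄`) and are lines — all read off the tree's discharges
`EndAction.iSup_eigenPiece_holds`, `iSupIndep_eigenPiece_holds`, `complexConj_iInf_eigenspace`,
`finrank_iInf_eigenspace_mul_finrank` (`Motives/WeilTypeCMProofs`) applied to the action on the TRIVIAL weight-zero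
Hodge structure `HodgeStructure.ofWeightZero E`; hence `P := ⨆_{σ ∈ Φ} L_σ` satisfies `ℂ ⊗ E = P ⊕ conj P`
(`isCompl_holPart`, the CM-type axiom `σ ∈ Φ ↔ σ̄ ∉ Φ`), and `HodgeStructure.ofSplitting P` (`Motives/HodgeStructureWeil`)
is the weight-one Hodge structure `CMTypeHodge.hodge E Φ` with `H^{1,0} = P`, on which `E` acts
(`CMTypeHodge.action`), with `H^{1,0}_σ = L_σ` for `σ ∈ Φ` and `0` otherwise.  The universe codes `(K, Φ)` by the
cell's `Model.cmCode K Φ` (field `ι(K) ⊂ ℂ`, transported type) and transports the action along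
`Model.cmCodeEquiv K Φ : K ≃+* ι(K)`; everything not on the CM side is trivial (one morphism between any two
varieties, zero pull-backs, cup products and traces, no algebraic classes).

Consequence (with `CorCM/Geometry/PerLShadow.lean`): `PerL ∧ PerL44 ∧ ¬ PeriodThmF` is satisfiable and
`¬ ∀ U, U.PerL → U.PeriodThmF` holds with NO hypothesis — recorded in the file that imports both.
-/

noncomputable section

open scoped TensorProduct
open NumberField

namespace Summit.HodgeConjecture.CorCM

open Literature.AlgebraicGeometry.Motives (CMType HodgeStructure)
open Literature.AlgebraicGeometry.Motives
open Literature.NumberTheory.ComplexMultiplication.CMTypeOps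

/-! ### The weight-one Hodge structure of a CM type on the field itself -/

namespace CMTypeHodge

variable (E : Type) [Field E] [NumberField E]

/-- The multiplication action of `E` on the trivial weight-zero Hodge structure on `E` (bootstrap: it lets the tree's
`EndAction` lemmas compute the eigen-line decomposition of `ℂ ⊗_ℚ E`). -/
def actionZero : (HodgeStructure.ofWeightZero E).EndAction E where
  ι := Algebra.lmul ℚ E
  map_F_le e p := by
    by_cases hp : p ≤ 0
    · rw [HodgeStructure.ofWeightZero_F, HodgeStructure.pureFiltration_of_le hp]
      exact le_top
    · rw [HodgeStructure.ofWeightZero_F, HodgeStructure.pureFiltration_of_lt (not_le.1 hp), Submodule.map_bot]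

/-- The `σ`-eigen-line `L_σ = {x ∈ ℂ ⊗_ℚ E | (1 ⊗ e) x = σ(e) x}` of the multiplication action. -/
def eigenLine (σ : E →+* ℂ) : Submodule ℂ (ℂ ⊗[ℚ] E) :=
  ⨅ e : E, Module.End.eigenspace ((Algebra.lmul ℚ E e).baseChange ℂ) (σ e)

/-- `V^{0,0} = ℂ ⊗ E` for the trivial weight-zero structure. -/
theorem piece_zero_zero_ofWeightZero : (HodgeStructure.ofWeightZero E).piece 0 0 = ⊤ := by
  rw [HodgeStructure.piece_of_add_eq _ (by norm_num), HodgeStructure.ofWeightZero_F,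
    HodgeStructure.pureFiltration_of_le le_rfl, HodgeStructure.complexConj_top, top_inf_eq]

/-- The eigen-pieces of the bootstrap action are the eigen-lines. -/
theorem eigenPiece_actionZero (σ : E →+* ℂ) : (actionZero E).eigenPiece σ 0 0 = eigenLine E σ := by
  rw [HodgeStructure.EndAction.eigenPiece, piece_zero_zero_ofWeightZero, top_inf_eq]
  rfl

/-- The eigen-lines span `ℂ ⊗_ℚ E` (`E ⊗ ℂ = ⊕_σ ℂ_σ`, spanning half). -/
theorem iSup_eigenLine : ⨆ σ : E →+* ℂ, eigenLine E σ = ⊤ := by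
  have h := HodgeStructure.EndAction.iSup_eigenPiece_holds (actionZero E) 0 0
  simp only [eigenPiece_actionZero, piece_zero_zero_ofWeightZero] at h
  exact h

/-- The eigen-lines are independent (`E ⊗ ℂ = ⊕_σ ℂ_σ`, independence half). -/
theorem iSupIndep_eigenLine : iSupIndep (eigenLine E) := by
  have h := HodgeStructure.EndAction.iSupIndep_eigenPiece_holds (actionZero E) 0 0
  simp only [eigenPiece_actionZero] at h
  exact h

/-- Complex conjugation exchanges `L_σ` and `L_σ̄`. -/
theorem complexConj_eigenLine (σ : E →+* ℂ) :
    HodgeStructure.complexConj (eigenLine E σ) = eigenLine E (ComplexEmbedding.conjugate σ) :=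
  HodgeStructure.EndAction.complexConj_iInf_eigenspace (actionZero E) σ

/-- Each eigen-line is a line: `dim_ℂ L_σ · [E:ℚ] = dim_ℚ E`. -/
theorem finrank_eigenLine (σ : E →+* ℂ) : Module.finrank ℂ (eigenLine E σ) = 1 := by
  have h := HodgeStructure.EndAction.finrank_iInf_eigenspace_mul_finrank (actionZero E) σ
  exact Nat.eq_of_mul_eq_mul_right Module.finrank_pos (h.trans (one_mul _).symm)

/-- The eigen-lines are stable under the action. -/
theorem baseChange_lmul_mem_eigenLine (e : E) {σ : E →+* ℂ} {x : ℂ ⊗[ℚ] E} (hx : x ∈ eigenLine E σ) :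
    (Algebra.lmul ℚ E e).baseChange ℂ x ∈ eigenLine E σ := by
  have h := (HodgeStructure.EndAction.mem_iInf_eigenspace_iff (actionZero E) σ x).1 hx e
  rw [show (Algebra.lmul ℚ E e).baseChange ℂ x = σ e • x from h]
  exact Submodule.smul_mem _ _ hx

variable (Φ : CMType E)

open Classical in
/-- The embeddings in the CM type, as a finite set. -/
def holIndex : Finset (E →+* ℂ) := Finset.univ.filter fun σ => σ ∈ Φ.1

open Classical in
/-- The embeddings outside the CM type, as a finite set. -/
def antiIndex : Finset (E →+* ℂ) := Finset.univ.filter fun σ => ¬ σ ∈ Φ.1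

/-- Membership in `holIndex`. -/
theorem mem_holIndex {σ : E →+* ℂ} : σ ∈ holIndex E Φ ↔ σ ∈ Φ.1 := by
  simp [holIndex]

/-- Membership in `antiIndex`. -/
theorem mem_antiIndex {σ : E →+* ℂ} : σ ∈ antiIndex E Φ ↔ σ ∉ Φ.1 := by
  simp [antiIndex]

/-- **`H^{1,0}` of the CM type**: `P = ⊕_{σ ∈ Φ} L_σ`. -/
def holPart : Submodule ℂ (ℂ ⊗[ℚ] E) := (holIndex E Φ).sup (eigenLine E)

/-- `L_σ ⊆ P` for `σ ∈ Φ`. -/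
theorem eigenLine_le_holPart {σ : E →+* ℂ} (hσ : σ ∈ Φ.1) : eigenLine E σ ≤ holPart E Φ :=
  Finset.le_sup (f := eigenLine E) ((mem_holIndex E Φ).2 hσ)

/-- `conj P = ⊕_{σ ∉ Φ} L_σ` (the CM-type axiom `σ ∈ Φ ↔ σ̄ ∉ Φ`). -/
theorem complexConj_holPart : HodgeStructure.complexConj (holPart E Φ) = (antiIndex E Φ).sup (eigenLine E) := by
  classical
  unfold holPart
  rw [Finset.apply_sup_eq_sup_comp HodgeStructure.complexConj HodgeStructure.complexConj_sup
    HodgeStructure.complexConj_bot]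
  have h1 : (holIndex E Φ).sup (HodgeStructure.complexConj ∘ eigenLine E) =
      (holIndex E Φ).sup (eigenLine E ∘ ComplexEmbedding.conjugate) :=
    Finset.sup_congr rfl fun σ _ => complexConj_eigenLine E σ
  rw [h1, ← Finset.sup_image]
  congr 1
  ext σ
  simp only [Finset.mem_image, mem_holIndex, mem_antiIndex]
  constructor
  · rintro ⟨τ, hτ, rfl⟩
    exact (mem_iff_conjugate_notMem Φ τ).1 hτ
  · intro hσ
    exact ⟨ComplexEmbedding.conjugate σ, (conjugate_mem_iff_notMem Φ σ).2 hσ,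
      ComplexEmbedding.involutive_conjugate E σ⟩

/-- `L_σ ⊆ conj P` for `σ ∉ Φ`. -/
theorem eigenLine_le_complexConj_holPart {σ : E →+* ℂ} (hσ : σ ∉ Φ.1) :
    eigenLine E σ ≤ HodgeStructure.complexConj (holPart E Φ) := by
  rw [complexConj_holPart]
  exact Finset.le_sup (f := eigenLine E) ((mem_antiIndex E Φ).2 hσ)

/-- **`ℂ ⊗ E = P ⊕ conj P`.** -/
theorem isCompl_holPart : IsCompl (holPart E Φ) (HodgeStructure.complexConj (holPart E Φ)) := by
  classical
  rw [complexConj_holPart]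
  have hind : (Finset.univ : Finset (E →+* ℂ)).SupIndep (eigenLine E) :=
    iSupIndep_iff_supIndep_univ.1 (iSupIndep_eigenLine E)
  refine ⟨hind.disjoint_sup_sup (Finset.subset_univ _) (Finset.subset_univ _) ?_, ?_⟩
  · unfold holIndex antiIndex
    exact Finset.disjoint_filter_filter_not _ _ _
  · rw [codisjoint_iff, holPart, ← Finset.sup_union]
    unfold holIndex antiIndex
    rw [Finset.filter_union_filter_not_eq, Finset.sup_univ_eq_iSup, iSup_eigenLine]

/-- **The weight-one Hodge structure of the CM type `Φ` on `E`**: `H^{1,0} = ⊕_{σ ∈ Φ} L_σ`,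
`H^{0,1} = ⊕_{σ ∉ Φ} L_σ` (Deligne, LNM 900, Example 3.7 / §4). -/
def hodge : HodgeStructure E 1 :=
  HodgeStructure.ofSplitting (holPart E Φ) (isCompl_holPart E Φ) one_pos

/-- `V^{1,0} = P`. -/
theorem piece_one_zero : (hodge E Φ).piece 1 0 = holPart E Φ :=
  HodgeStructure.piece_ofSplitting_self_zero _ _ _

/-- **The CM action**: `E` acts on `hodge E Φ` by multiplication (it preserves `P`, a sum of eigen-lines). -/
def action : (hodge E Φ).EndAction E where
  ι := Algebra.lmul ℚ E
  map_F_le e p := by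
    show Submodule.map _ (HodgeStructure.twoStepFiltration (holPart E Φ) 1 p) ≤
      HodgeStructure.twoStepFiltration (holPart E Φ) 1 p
    by_cases hp : p ≤ 0
    · rw [HodgeStructure.twoStepFiltration_of_le_zero _ hp]
      exact le_top
    by_cases hp1 : 1 < p
    · rw [HodgeStructure.twoStepFiltration_of_lt _ (not_le.1 hp) hp1, Submodule.map_bot]
    obtain rfl : p = 1 := by omega
    rw [HodgeStructure.twoStepFiltration_of_pos_of_le _ one_pos le_rfl]
    refine Submodule.map_le_iff_le_comap.2 (Finset.sup_le fun σ hσ => ?_)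
    intro x hx
    exact Finset.le_sup (f := eigenLine E) hσ (baseChange_lmul_mem_eigenLine E e hx)

/-- `H^{1,0}_σ = L_σ` for `σ ∈ Φ`. -/
theorem eigenPiece_one_zero_of_mem {σ : E →+* ℂ} (hσ : σ ∈ Φ.1) :
    (action E Φ).eigenPiece σ 1 0 = eigenLine E σ := by
  rw [HodgeStructure.EndAction.eigenPiece, piece_one_zero]
  show holPart E Φ ⊓ eigenLine E σ = eigenLine E σ
  exact inf_eq_right.2 (eigenLine_le_holPart E Φ hσ)

/-- `H^{1,0}_σ = 0` for `σ ∉ Φ`. -/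
theorem eigenPiece_one_zero_of_not_mem {σ : E →+* ℂ} (hσ : σ ∉ Φ.1) :
    (action E Φ).eigenPiece σ 1 0 = ⊥ := by
  rw [HodgeStructure.EndAction.eigenPiece, piece_one_zero]
  show holPart E Φ ⊓ eigenLine E σ = ⊥
  exact eq_bot_iff.2 (le_trans (inf_le_inf_left _ (eigenLine_le_complexConj_holPart E Φ hσ))
    (isCompl_holPart E Φ).inf_eq_bot.le)

/-- The CM action transported to an abstract field `K ≃+* E`. -/
def actionOfEquiv {K : Type} [Field K] [NumberField K] (e : K ≃+* E) : (hodge E Φ).EndAction K where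
  ι := (action E Φ).ι.comp e.toRingHom.toRatAlgHom
  map_F_le k p := (action E Φ).map_F_le (e k) p

end CMTypeHodge

/-! ### The CM-type universe -/

open Literature.NumberTheory.Automorphic.PicardCM (CMCode)
open Literature.NumberTheory.Automorphic.PicardCM

/-- A CM field has even degree. -/
theorem even_finrank_of_isCMField (E : Type) [Field E] [NumberField E] [IsCMField E] :
    Even (Module.finrank ℚ E) :=
  ⟨InfinitePlace.nrComplexPlaces E, by rw [IsTotallyComplex.finrank, two_mul]⟩

/-- **The CM-type universe.** Varieties are the CM codes `(E ⊂ ℂ, Φ)` of the tree; `H^k` of a code is its field `E`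
in every degree, with the CM-type Hodge structure `CMTypeHodge.hodge E Φ` in degree `1` (and some Hodge structure
in the other degrees); `A_{(K,Φ)}` is the cell's code `Model.cmCode K Φ` with the multiplication action of `K`
transported along `Model.cmCodeEquiv K Φ`.  Everything else is trivial: one morphism between any two varieties,
zero pull-backs, cup products and traces, no algebraic classes; Picard modular surfaces are coded arbitrarily. -/
def cmTypeUniverse : Universe where
  Var := CMCode
  dim c := Module.finrank ℚ c.E / 2
  Coh c _ := c.E
  hodge c k := match k with
    | 1 => CMTypeHodge.hodge c.E c.Φ
    | 0 => (HodgeStructure.nonempty_of_even_finrank (even_finrank_of_isCMField c.E) _).some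
    | _ + 2 => (HodgeStructure.nonempty_of_even_finrank (even_finrank_of_isCMField c.E) _).some
  alg _ _ := ⊥
  Mor _ _ := PUnit
  idMor _ := PUnit.unit
  comp _ _ := PUnit.unit
  pull _ _ := 0
  cup _ _ _ := 0
  tr _ _ := 0
  prod c _ := c
  fst _ _ := PUnit.unit
  snd _ _ := PUnit.unit
  IsAbelianVariety _ := True
  IsCMAbelianVariety _ := True
  cmAV K Φ := Model.cmCode K Φ
  cmAct K Φ := CMTypeHodge.actionOfEquiv (Model.cmCode K Φ).E (Model.cmCode K Φ).Φ (Model.cmCodeEquiv K Φ)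
  pms L ι₁ _ _ := CMCode.ofCMType ι₁ ⟨Set.range fun w : InfinitePlace L => w.embedding, range_embedding_isCMType L⟩

/-- The eigen-lines of the CM-type universe are the eigen-lines `L_{σ'}` of the code field, `σ' = σ ∘ e⁻¹`. -/
theorem cmTypeUniverse_eigenLine (K : CMField) (Φ : CMType K) (σ : K →+* ℂ) :
    cmTypeUniverse.eigenLine K Φ σ =
      CMTypeHodge.eigenLine (Model.cmCode K Φ).E (σ.comp (Model.cmCodeEquiv K Φ).symm.toRingHom) := by
  show (⨅ k : K, Module.End.eigenspace
      ((Algebra.lmul ℚ (Model.cmCode K Φ).E (Model.cmCodeEquiv K Φ k)).baseChange ℂ) (σ k)) = ⨅ e', _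
  refine Equiv.iInf_congr (Model.cmCodeEquiv K Φ).toEquiv fun k => ?_
  exact congrArg
    (fun μ => Module.End.eigenspace ((Algebra.lmul ℚ (Model.cmCode K Φ).E (Model.cmCodeEquiv K Φ k)).baseChange ℂ) μ)
    (congrArg σ ((Model.cmCodeEquiv K Φ).symm_apply_apply k))

/-- The holomorphic eigen-lines of the CM-type universe are the eigen-pieces `H^{1,0}_{σ'}` of `CMTypeHodge.action`. -/
theorem cmTypeUniverse_alphaLine (K : CMField) (Φ : CMType K) (σ : K →+* ℂ) :
    cmTypeUniverse.alphaLine K Φ σ =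
      (CMTypeHodge.action (Model.cmCode K Φ).E (Model.cmCode K Φ).Φ).eigenPiece
        (σ.comp (Model.cmCodeEquiv K Φ).symm.toRingHom) 1 0 := by
  show (CMTypeHodge.hodge (Model.cmCode K Φ).E (Model.cmCode K Φ).Φ).piece 1 0 ⊓ cmTypeUniverse.eigenLine K Φ σ =
    (CMTypeHodge.hodge (Model.cmCode K Φ).E (Model.cmCode K Φ).Φ).piece 1 0 ⊓
      CMTypeHodge.eigenLine (Model.cmCode K Φ).E (σ.comp (Model.cmCodeEquiv K Φ).symm.toRingHom)
  rw [cmTypeUniverse_eigenLine]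

/-- **M13 `Fact_eigenLine` holds on the CM-type universe**, unconditionally. -/
theorem cmTypeUniverse_fact_eigenLine : cmTypeUniverse.Fact_eigenLine := fun K Φ σ => by
  rw [cmTypeUniverse_eigenLine]
  exact CMTypeHodge.finrank_eigenLine (Model.cmCode K Φ).E _

/-- **M14 `Fact_alphaLine` holds on the CM-type universe**, unconditionally. -/
theorem cmTypeUniverse_fact_alphaLine : cmTypeUniverse.Fact_alphaLine := fun K Φ σ =>
  ⟨fun hσ => by
      rw [cmTypeUniverse_alphaLine, cmTypeUniverse_eigenLine]
      exact CMTypeHodge.eigenPiece_one_zero_of_mem (Model.cmCode K Φ).E (Model.cmCode K Φ).Φ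
        ((Model.cmCodeEmb_mem_iff K Φ σ).2 hσ),
    fun hσ => by
      rw [cmTypeUniverse_alphaLine]
      exact CMTypeHodge.eigenPiece_one_zero_of_not_mem (Model.cmCode K Φ).E (Model.cmCode K Φ).Φ fun h =>
        hσ ((Model.cmCodeEmb_mem_iff K Φ σ).1 h)⟩

end Summit.HodgeConjecture.CorCM

end
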